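import Literature.AlgebraicGeometry.Frobenioids.Cor412OfFSMType
import Literature.AlgebraicGeometry.Frobenioids.EquivalenceThm34ivClosed
import HarnessLib

/-!
# Frobenioids I, Corollary 4.12 AS TYPED over bases of FSM-type — UNCONDITIONAL closer (no named fact):
# Theorem 3.4 (iv) is consumed as the tree THEOREM `FrdI.thm34iv_ofFunctor_of_isOfFSMType` at the
# birationalizations

Mochizuki, *The geometry of Frobenioids I: the general theory*, Kyushu J. Math. **62** (2008)
293–400, kurims text, Cor. 4.12 p. 94 l. 44 – p. 95 l. 17, proof p. 95 ll. 18–40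
[cite: MochizukiFrdI2008, Cor. 4.12 p.95].

PROOF-ONLY (cell sub-DAG W9 = `plan/L1/SUBDAG-FrdI-Cor412.md`; seat abc-iut-w5-d222; the pointer that
Thm. 3.4 (iv) over FSM-type bases is CLOSED in the tree — `FrdI.thm34iv_ofFunctor_of_isOfFSMType`,
`EquivalenceThm34ivClosed.lean`, abc-iut-w4-d093 — is abc-iut-w4-d033's, STATUS 2026-08-26T01:38:29Z).
`Cor412OfFSMType.lean` closes the typed Cor. 4.12 GIVEN the bare named fact `FrdI.Thm34iv` (print's FSMFF
generality, the cell's open residual G-L1d8-1). Over bases of FSM-type that fact is only ever USED at the two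
birationalizations `(C_i^istr)^birat → F_{0_{D_i}}` — themselves Frobenioids over the same FSM-type bases — where
Thm. 3.4 (iv) IS a theorem of the tree. Hence:

* `PreFrobenioid.Birat.exists_equivalence_over` — Cor. 4.10's `Ψ^birat` packaged: an equivalence
  `Eb : C₁^birat ≌ C₂^birat` with functor `mapOfEquiv Ψ` and inverse `mapOfEquiv Ψ⁻¹`
  (`Localization.equivalence`, abc-iut-L1-t10), its square over `Ψ`, and hypothesis (b) `HypB` for `Eb` and
  `Eb.symm` ("`Ψ^birat` preserves base-isomorphisms", Prop. 4.4 (iv) + Thm. 3.4 (iii); abc-iut-L6-t20);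
* `FrdI.exists_toBaseDeg_equivalence_of_isOfFSMType` — the `F_{0_D}`-square for Frobenioids of isotropic type
  over FSM-type bases, the units of `Ψ^birat` and of its quasi-inverse supplied by
  `FrdI.thm34iv_ofFunctor_of_isOfFSMType` at the birationalizations;
* `FrdI.cor412_of_isOfFSMType` — **the typed Cor. 4.12 for every pair of Frobenioids over FSM-type bases and
  every `Ψ`, with NO named fact**: the only remaining inputs are, at `C_i^istr`, THE birationalizations'
  Frobenioid structures `hB_i` (Prop. 4.4 (ii) first sentence — cell row W14 `BiratIsFrobenioid`) and their
  standard type `hstd_i` (Prop. 4.8 (iii) — verbatim the conclusion of `prop48iii_of_frobeniusCompact`).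

No statement of the paper is restated as a `Prop` or strengthened; nothing here is specific to the abc
programme or bears on [IUTchIII] Cor. 3.12.
-/

namespace Literature.AlgebraicGeometry.Frobenioids

open CategoryTheory Opposite

universe w v v' u u'

namespace PreFrobenioid

namespace Birat

variable {D₁ : Type u} [Category.{v} D₁] {Φ₁ : D₁ᵒᵖ ⥤ CommMonCat.{w}}
  {C₁ : Type u'} [Category.{v'} C₁] {F₁ : C₁ ⥤ ElemFrobenioid Φ₁}
  {D₂ : Type u} [Category.{v} D₂] {Φ₂ : D₂ᵒᵖ ⥤ CommMonCat.{w}}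
  {C₂ : Type u'} [Category.{v'} C₂] {F₂ : C₂ ⥤ ElemFrobenioid Φ₂}

/-- **Cor. 4.10's `Ψ^birat`, packaged with hypothesis (b) of Thm. 3.4 (iv)** ([FrdI] p. 95 ll. 30–34:
"applying Corollary 4.10 to pass from `C_i` to `C_i^birat` [where we note that, by Proposition 4.4, (iv),
and Theorem 3.4, (iii), it follows that the resulting equivalence of categories `Ψ^birat` preserves
base-isomorphisms]"): if `Ψ`, `Ψ⁻¹` preserve co-angular pre-steps (Thm. 3.4 (ii)) and base-isomorphisms
(Thm. 3.4 (iii)), there is an equivalence `Eb : C₁^birat ≌ C₂^birat` — functor `mapOfEquiv Ψ`, inverse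
`mapOfEquiv Ψ⁻¹` (abc-iut-L1-t10; `Localization.equivalence`) — lying over `Ψ`, such that `Eb` and
`Eb.symm` satisfy `HypB` for the operations `C_i^birat → F_{0_{D_i}}` (abc-iut-L6-t20's
`isBaseIso_mapOfEquiv_map`). [cite: MochizukiFrdI2008, Cor. 4.12 p.95] -/
theorem exists_equivalence_over (hF₁ : IsFrobenioid F₁) (hsq₁ : HasBiratSquares F₁)
    (hF₂ : IsFrobenioid F₂) (hsq₂ : HasBiratSquares F₂) (Ψ : C₁ ≌ C₂)
    (hΨ : ∀ ⦃A B : C₁⦄ (f : A ⟶ B), IsCoAngularPreStep F₁ f → IsCoAngularPreStep F₂ (Ψ.functor.map f))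
    (hΨ' : ∀ ⦃A B : C₂⦄ (f : A ⟶ B), IsCoAngularPreStep F₂ f → IsCoAngularPreStep F₁ (Ψ.inverse.map f))
    (hbi : PreFrobenioidData.PreservesMor Ψ.functor (PreFrobenioidData.ofFunctor Φ₁ F₁).IsBaseIso
      (PreFrobenioidData.ofFunctor Φ₂ F₂).IsBaseIso)
    (hbi' : PreFrobenioidData.PreservesMor Ψ.inverse (PreFrobenioidData.ofFunctor Φ₂ F₂).IsBaseIso
      (PreFrobenioidData.ofFunctor Φ₁ F₁).IsBaseIso) :
    ∃ Eb : Birat F₁ hF₁ hsq₁ ≌ Birat F₂ hF₂ hsq₂,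
      Nonempty (toBirat F₁ hF₁ hsq₁ ⋙ Eb.functor ≅ Ψ.functor ⋙ toBirat F₂ hF₂ hsq₂) ∧
        (biratOps hF₁ hsq₁).HypB (biratOps hF₂ hsq₂) Eb ∧ (biratOps hF₂ hsq₂).HypB (biratOps hF₁ hsq₁) Eb.symm := by
  haveI := toBirat_isLocalization hF₁ hsq₁
  haveI := toBirat_isLocalization hF₂ hsq₂
  letI := liftingMapOfEquiv hF₁ hsq₁ hF₂ hsq₂ Ψ hΨ
  let F' : Birat F₂ hF₂ hsq₂ ⥤ Birat F₁ hF₁ hsq₁ := mapOfEquiv hF₂ hsq₂ hF₁ hsq₁ Ψ.symm hΨ'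
  let fac' : toBirat F₂ hF₂ hsq₂ ⋙ F' ≅ Ψ.inverse ⋙ toBirat F₁ hF₁ hsq₁ :=
    mapOfEquivFac hF₂ hsq₂ hF₁ hsq₁ Ψ.symm hΨ'
  letI : Localization.Lifting (toBirat F₂ hF₂ hsq₂) (coAngularPreSteps F₂)
      (Ψ.inverse ⋙ toBirat F₁ hF₁ hsq₁) F' := ⟨fac'⟩
  let α : (Ψ.functor ⋙ toBirat F₂ hF₂ hsq₂) ⋙ F' ≅ toBirat F₁ hF₁ hsq₁ :=
    Functor.associator _ _ _ ≪≫ Functor.isoWhiskerLeft Ψ.functor fac' ≪≫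
      (Functor.associator _ _ _).symm ≪≫ Functor.isoWhiskerRight Ψ.unitIso.symm _ ≪≫
        Functor.leftUnitor _
  let β : (Ψ.inverse ⋙ toBirat F₁ hF₁ hsq₁) ⋙ mapOfEquiv hF₁ hsq₁ hF₂ hsq₂ Ψ hΨ ≅ toBirat F₂ hF₂ hsq₂ :=
    Functor.associator _ _ _ ≪≫
      Functor.isoWhiskerLeft Ψ.inverse (mapOfEquivFac hF₁ hsq₁ hF₂ hsq₂ Ψ hΨ) ≪≫
        (Functor.associator _ _ _).symm ≪≫ Functor.isoWhiskerRight Ψ.counitIso _ ≪≫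
          Functor.leftUnitor _
  let Eb : Birat F₁ hF₁ hsq₁ ≌ Birat F₂ hF₂ hsq₂ :=
    Localization.equivalence (toBirat F₁ hF₁ hsq₁) (coAngularPreSteps F₁) (toBirat F₂ hF₂ hsq₂)
      (coAngularPreSteps F₂) (Ψ.functor ⋙ toBirat F₂ hF₂ hsq₂) (mapOfEquiv hF₁ hsq₁ hF₂ hsq₂ Ψ hΨ)
      (Ψ.inverse ⋙ toBirat F₁ hF₁ hsq₁) F' α β
  have hpres : PreFrobenioidData.PreservesMor Eb.functor (biratOps hF₁ hsq₁).IsBaseIso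
      (biratOps hF₂ hsq₂).IsBaseIso :=
    fun X Y g hg => isBaseIso_mapOfEquiv_map hF₁ hsq₁ hF₂ hsq₂ Ψ hΨ hbi g hg
  have hpres' : PreFrobenioidData.PreservesMor Eb.inverse (biratOps hF₂ hsq₂).IsBaseIso
      (biratOps hF₁ hsq₁).IsBaseIso :=
    fun X Y g hg => isBaseIso_mapOfEquiv_map hF₂ hsq₂ hF₁ hsq₁ Ψ.symm hΨ' hbi' g hg
  exact ⟨Eb, ⟨mapOfEquivFac hF₁ hsq₁ hF₂ hsq₂ Ψ hΨ⟩, fun _ _ => ⟨hpres, hpres'⟩, fun _ _ => ⟨hpres', hpres⟩⟩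

end Birat

end PreFrobenioid

namespace FrdI

open PreFrobenioid

section Isotropic

variable {D₁ : Type u} [Category.{v} D₁] {Φ₁ : D₁ᵒᵖ ⥤ CommMonCat.{w}}
  {C₁ : Type u'} [Category.{v'} C₁] {F₁ : C₁ ⥤ ElemFrobenioid Φ₁}
  {D₂ : Type u} [Category.{v} D₂] {Φ₂ : D₂ᵒᵖ ⥤ CommMonCat.{w}}
  {C₂ : Type u'} [Category.{v'} C₂] {F₂ : C₂ ⥤ ElemFrobenioid Φ₂}

/-- **The `F_{0_D}`-square of Cor. 4.12 over FSM-type bases, unconditionally in Thm. 3.4 (iv)**, for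
Frobenioids of isotropic type (print p. 95 ll. 30–39): as `exists_toBaseDeg_equivalence_of_thm34iv`, with the
units of `Ψ^birat` and of its quasi-inverse taken from the tree THEOREM `FrdI.thm34iv_ofFunctor_of_isOfFSMType`
(abc-iut-w4-d093) for the Frobenioids `C_i^birat → F_{0_{D_i}}` (`hB_i`, Prop. 4.4 (ii)) over the FSM-type bases
`D_i`, its premises being standard type `hstd_i` (Prop. 4.8 (iii)), `HypB` (`Birat.exists_equivalence_over`)
and Frobenius-slimness. [cite: MochizukiFrdI2008, Cor. 4.12 p.95] -/
theorem exists_toBaseDeg_equivalence_of_isOfFSMType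
    (hF₁ : IsFrobenioid F₁) (hsq₁ : HasBiratSquares F₁) (hF₂ : IsFrobenioid F₂) (hsq₂ : HasBiratSquares F₂)
    (Ψ : C₁ ≌ C₂)
    (hB₁ : IsFrobenioid (Birat.toElemZero hF₁ hsq₁)) (hB₂ : IsFrobenioid (Birat.toElemZero hF₂ hsq₂))
    (hC₁ : (PreFrobenioidData.ofFunctor Φ₁ F₁).IsOfIsotropicType)
    (hC₂ : (PreFrobenioidData.ofFunctor Φ₂ F₂).IsOfIsotropicType)
    (hD₁ : IsOfFSMType D₁) (hD₂ : IsOfFSMType D₂)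
    (hstd₁ : (biratOps hF₁ hsq₁).IsOfStandardType) (hstd₂ : (biratOps hF₂ hsq₂).IsOfStandardType)
    (hfs₁ : IsFrobeniusSlim D₁) (hfs₂ : IsFrobeniusSlim D₂)
    (hΨ : ∀ ⦃A B : C₁⦄ (f : A ⟶ B), IsCoAngularPreStep F₁ f → IsCoAngularPreStep F₂ (Ψ.functor.map f))
    (hΨ' : ∀ ⦃A B : C₂⦄ (f : A ⟶ B), IsCoAngularPreStep F₂ f → IsCoAngularPreStep F₁ (Ψ.inverse.map f))
    (hbi : PreFrobenioidData.PreservesMor Ψ.functor (PreFrobenioidData.ofFunctor Φ₁ F₁).IsBaseIso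
      (PreFrobenioidData.ofFunctor Φ₂ F₂).IsBaseIso)
    (hbi' : PreFrobenioidData.PreservesMor Ψ.inverse (PreFrobenioidData.ofFunctor Φ₂ F₂).IsBaseIso
      (PreFrobenioidData.ofFunctor Φ₁ F₁).IsBaseIso) :
    ∃ Ψ0 : D₁ × SingleObj ℕ+ ⥤ D₂ × SingleObj ℕ+, Ψ0.IsEquivalence ∧
      OneCommutes Ψ.functor (PreFrobenioidData.ofFunctor Φ₂ F₂).toBaseDeg
        (PreFrobenioidData.ofFunctor Φ₁ F₁).toBaseDeg Ψ0 := by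
  obtain ⟨Eb, ⟨sq⟩, hHypB, hHypB'⟩ :=
    Birat.exists_equivalence_over hF₁ hsq₁ hF₂ hsq₂ Ψ hΨ hΨ' hbi hbi'
  -- Thm. 3.4 (iv) (tree theorem over FSM-type bases) for `Ψ^birat` and for its quasi-inverse: `O^×(−)`
  obtain ⟨-, hu, -⟩ := FrdI.thm34iv_ofFunctor_of_isOfFSMType hB₁ hB₂ hD₁ hD₂ Eb hstd₁ hstd₂ hHypB hfs₁ hfs₂
  obtain ⟨-, hu', -⟩ :=
    FrdI.thm34iv_ofFunctor_of_isOfFSMType hB₂ hB₁ hD₂ hD₁ Eb.symm hstd₂ hstd₁ hHypB' hfs₂ hfs₁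
  exact exists_toBaseDeg_equivalence_of_birat_pieces hF₁ hsq₁ hF₂ hsq₂ Ψ hB₁ hB₂ hstd₁.fsmff hstd₂.fsmff
    (PreFrobenioidData.isOfIsotropicType_ofFunctor_toElemZero hF₁ hsq₁ hC₁)
    (PreFrobenioidData.isOfIsotropicType_ofFunctor_toElemZero hF₂ hsq₂ hC₂) Eb sq hu hu'

end Isotropic

section General

variable {D₁ : Type u} [Category.{v} D₁] {Φ₁ : D₁ᵒᵖ ⥤ CommMonCat.{w}}
  {C₁ : Type u'} [Category.{v'} C₁] {F₁ : C₁ ⥤ ElemFrobenioid Φ₁}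
  {D₂ : Type u} [Category.{v} D₂] {Φ₂ : D₂ᵒᵖ ⥤ CommMonCat.{w}}
  {C₂ : Type u'} [Category.{v'} C₂] {F₂ : C₂ ⥤ ElemFrobenioid Φ₂}

/-- **[FrdI] Corollary 4.12 AS TYPED, for every pair of Frobenioids over bases of FSM-type — with NO named
fact** (print p. 94 l. 44 – p. 95 l. 40): for Frobenioids `C_i → F_{Φ_i}` over bases `D_i` of FSM-type and an
equivalence `Ψ : C₁ ⥲ C₂`, GIVEN only — at the Frobenioids `C_i^istr` — THE birationalizations' Frobenioid
structures `(C_i^istr)^birat → F_{0_{D_i}}` (Prop. 4.4 (ii) first sentence, `hB_i`) of standard type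
(Prop. 4.8 (iii), `hstd_i`), the typed Cor. 4.12 (`PreFrobenioidData.Cor412`) holds for `Ψ` under its own printed
antecedents ("`D_i` Frobenius-slim", "`C_i` of rationally standard type", (b) `HypB`): a `1`-unique
`Ψ⁰ : F_{0_{D₁}} ⥲ F_{0_{D₂}}` `1`-commuting with `Ψ` over `C_i → F_{0_{D_i}}`, with rigid composites over slim
bases. Route = print's: Thm. 3.4 (i) (abc-iut-w4-d088), Rem. 4.5.1, Cor. 4.10 (abc-iut-L1-t10), Prop. 4.4 (iv)
+ Thm. 3.4 (iii) (abc-iut-L6-t20 / w4-d033 / L1-t13), Thm. 3.4 (iv) (abc-iut-w4-d093), Prop. 4.8 (i),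
unit-trivialization (abc-iut-L1-d5/d6), Prop. 3.11 (i), "composing diagrams", Prop. 1.13 (i).
[cite: MochizukiFrdI2008, Cor. 4.12 p.95] -/
theorem cor412_of_isOfFSMType (hF₁ : IsFrobenioid F₁) (hF₂ : IsFrobenioid F₂)
    (hD₁ : IsOfFSMType D₁) (hD₂ : IsOfFSMType D₂)
    (hsq₁ : HasBiratSquares (istrFunctor F₁)) (hsq₂ : HasBiratSquares (istrFunctor F₂))
    (hB₁ : IsFrobenioid (Birat.toElemZero (isFrobenioid_istr hF₁) hsq₁))
    (hB₂ : IsFrobenioid (Birat.toElemZero (isFrobenioid_istr hF₂) hsq₂))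
    (hstd₁ : (biratOps (isFrobenioid_istr hF₁) hsq₁).IsOfStandardType)
    (hstd₂ : (biratOps (isFrobenioid_istr hF₂) hsq₂).IsOfStandardType) (Ψ : C₁ ≌ C₂)
    (R₁ : (PreFrobenioidData.ofFunctor Φ₁ F₁).RSParams) (R₂ : (PreFrobenioidData.ofFunctor Φ₂ F₂).RSParams) :
    (PreFrobenioidData.ofFunctor Φ₁ F₁).Cor412 (PreFrobenioidData.ofFunctor Φ₂ F₂) Ψ R₁ R₂ := by
  intro hfs₁ hfs₂ hR₁ hR₂ hB
  have hs₁ := hR₁.standard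
  have hs₂ := hR₂.standard
  -- Thm. 3.4 (i): the restriction `Ψ^istr` and its square with the isotropifications
  haveI : (isotropicObjects F₂).IsClosedUnderIsomorphisms :=
    ⟨fun e hX => IsIsotropic.of_iso hF₂.isPreFrobenioid e.symm hX⟩
  have hinv := FrdI.isotropicObjects_inverseImage hF₁ hs₁.quasiIsotropic hs₂.quasiIsotropic Ψ
  let Ψi : Istr F₁ ≌ Istr F₂ := Ψ.congrFullSubcategory hinv
  obtain ⟨core⟩ := nonempty_isotropification_comp_iso hF₁ hF₂ hs₁.quasiIsotropic hs₂.quasiIsotropic Ψ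
  -- Rem. 4.5.1: `C_i^istr` of standard type; hypothesis (b) for `Ψ^istr` and for its inverse
  have hs₁' := isOfStandardType_istr hF₁ hs₁
  have hs₂' := isOfStandardType_istr hF₂ hs₂
  have hBi : (PreFrobenioidData.ofFunctor Φ₁ (istrFunctor F₁)).HypB
      (PreFrobenioidData.ofFunctor Φ₂ (istrFunctor F₂)) Ψi := hypB_istr hF₁ hF₂ Ψ hinv hB
  have hBi' : (PreFrobenioidData.ofFunctor Φ₂ (istrFunctor F₂)).HypB
      (PreFrobenioidData.ofFunctor Φ₁ (istrFunctor F₁)) Ψi.symm :=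
    fun hg₂ hg₁ => ⟨(hBi hg₁ hg₂).2, (hBi hg₁ hg₂).1⟩
  -- Thm. 3.4 (ii): `Ψ^istr`, `(Ψ^istr)⁻¹` preserve co-angular pre-steps (bases of FSM-type)
  have hΨ : ∀ ⦃A B : Istr F₁⦄ (f : A ⟶ B),
      IsCoAngularPreStep (istrFunctor F₁) f → IsCoAngularPreStep (istrFunctor F₂) (Ψi.functor.map f) :=
    fun A B f hf => FrdI.isCoAngularPreStep_map_of_quasiIsotropic_of_isOfFSMType (isFrobenioid_istr hF₁)
      (isFrobenioid_istr hF₂) hs₁'.quasiIsotropic hs₂'.quasiIsotropic hD₂ Ψi hf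
  have hΨ' : ∀ ⦃A B : Istr F₂⦄ (f : A ⟶ B),
      IsCoAngularPreStep (istrFunctor F₂) f → IsCoAngularPreStep (istrFunctor F₁) (Ψi.inverse.map f) :=
    fun A B f hf => FrdI.isCoAngularPreStep_map_of_quasiIsotropic_of_isOfFSMType (isFrobenioid_istr hF₂)
      (isFrobenioid_istr hF₁) hs₂'.quasiIsotropic hs₁'.quasiIsotropic hD₁ Ψi.symm hf
  -- Thm. 3.4 (iii): `Ψ^istr`, `(Ψ^istr)⁻¹` preserve base-isomorphisms (bases of FSM-type)
  obtain ⟨⟨-, -, hbi, -, -, -, -⟩, -⟩ := FrdI.thm34iii_ofFunctor_of_isOfFSMType (isFrobenioid_istr hF₁)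
    (isFrobenioid_istr hF₂) hD₁ hD₂ Ψi hs₁' hs₂' hBi
  obtain ⟨⟨-, -, hbi', -, -, -, -⟩, -⟩ := FrdI.thm34iii_ofFunctor_of_isOfFSMType (isFrobenioid_istr hF₂)
    (isFrobenioid_istr hF₁) hD₂ hD₁ Ψi.symm hs₂' hs₁' hBi'
  exact cor412_of_istr hF₁ hF₂ Ψ Ψi core
    (exists_toBaseDeg_equivalence_of_isOfFSMType (isFrobenioid_istr hF₁) hsq₁ (isFrobenioid_istr hF₂) hsq₂
      Ψi hB₁ hB₂
      ((PreFrobenioidData.ofFunctor_isOfIsotropicType _).2 isOfIsotropicType_istr)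
      ((PreFrobenioidData.ofFunctor_isOfIsotropicType _).2 isOfIsotropicType_istr)
      hD₁ hD₂ hstd₁ hstd₂ hfs₁ hfs₂ hΨ hΨ' hbi hbi')
    R₁ R₂ hfs₁ hfs₂ hR₁ hR₂ hB

end General

end FrdI

end Literature.AlgebraicGeometry.Frobenioids
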